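import Literature.Barriers.CriticalPhenomena.PlaquetteWalkHoleRootSevenAboveClassesWest
import HarnessLib

/-!
# Barrier catalogue (SAWScalingLimit): THE COLUMN LAW ABOVE THE ROOT ROW — finitely many zeros of the printed vertex functional, given one member («COLUMN LAW»)

`Z → ∞` limit model of the printed Yang–Baxter weights [GlazmanManolescu2019, §1, eq. (1)]; the «RECTANGLE COEFFICIENT» line of the venture lane «pcv-sawmu»
(b-engine-1 g27), assembly. The phase hypothesis `hphase` of `vertexFunctional_printed_zero_set_finite_above_of_phase` (#1099) is DISCHARGED: at a rooted
rhombus `f₀` strictly above the root row with `w.1 ≤ f₀.1`, a wound class-`B2a` walk whose extension `ext₃ ω` has limit cost `5` is a cost-`7` parent with a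
vertical end (`ΩG.cost_ext₃_eq_five_iff`; the cost-`5` alternative lives on the root row, `ΩG.rootRow_of_cost_five`), and its extension has phase index `3`
or `6` by `ΩG.phaseIndex_ext₃_of_cost_seven_E_above` (end side `E`) and `ΩG.phaseIndex_ext₃_of_cost_seven_W_above` (end side `W`). Hence ★★★★★
`vertexFunctional_printed_zero_set_finite_above` / `vertexFunctional_printed_exists_ne_zero_above`: if at least one such member exists at `f₀`, the printed
vertex functional `θ ↦ VF_{dom Dl}(w.side W, f₀; θ)` has at most `4·maxExp − 4` zeros in `(0, π)` and in particular is not identically zero — the COLUMN LAW of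
FINDING-YB-LEVEL5-PHASE-LAW §3–§4 above the root row, modulo the existence of a member (one transported witness per cell, as for the root row in
`PlaquetteWalkHoleRootRowLawWitness`). [GlazmanManolescu2019 §1 Fig. 1, eq. (1), Lemma 2.1 (eq. (CR)), Remark 2.2; Glazman2015WeightedSAW Lemma 3.1 (proof, pp. 6–7);
CourantRobbins1958 Ch. V App. §2]
-/

noncomputable section

namespace Literature.Barriers.CriticalPhenomena.PlaquetteWalk

open Literature.Probability.RandomPlanarGeometry.SAW.YangBaxter
open Real

variable (Dl : List Face)

/-- ★★★★★ **THE COLUMN LAW ABOVE THE ROOT ROW (finite zero set).** Let `a = w.side W` be a `W`-normalised hole root of `dom Dl` (hole absent) and `f₀` a rooted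
rhombus STRICTLY ABOVE the root row with `w.1 ≤ f₀.1`, carrying at least one wound class-`B2a` walk whose first arc in `f₀` turns and whose extension has limit
cost `5`. Then the zero set in `θ ∈ (0, π)` of the printed-weight vertex functional at `f₀` is finite, with at most `4·maxExp − 4` elements.
[cite: GlazmanManolescu2019, Lemma 2.1 and eq. (1); Remark 2.2] [cite: Glazman2015WeightedSAW, Lemma 3.1 (proof, pp. 6–7)]
[cite: CourantRobbins1958, Ch. V Appendix §2 (the even–odd rule)] -/
theorem vertexFunctional_printed_zero_set_finite_above {w f₀ : Face} (hh : holeFaceW w ∉ dom Dl)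
    (hr : RootedFace (dom Dl) (w.side .W) f₀) (habove : w.2 < f₀.2) (hcol : w.1 ≤ f₀.1)
    (hex : ∃ (ω : ΩG (dom Dl) (w.side .W) f₀) (h : ω.IsB2a), ω.AJ hr h (toC (midPt (w.side .W))) ≠ 0 ∧
      arcKind (ω.2.sIn ω.2.firstHitG) (ω.2.sOut ω.2.firstHitG) ≠ .straight ∧
        cost (slotOfSide (ω.ext₃ hr).1) (ω.ext₃ hr).2.mids = 5) :
    {θ ∈ Set.Ioo 0 π | vertexFunctional (printedWeights θ) tFiveEighths (ybCoeff θ) Dl (w.side .W) f₀ = 0}.Finite ∧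
      {θ ∈ Set.Ioo 0 π | vertexFunctional (printedWeights θ) tFiveEighths (ybCoeff θ) Dl (w.side .W) f₀ = 0}.ncard ≤
        4 * maxExp Dl (w.side .W) f₀ + 1 - 5 := by
  refine vertexFunctional_printed_zero_set_finite_above_of_phase Dl hh hr habove hcol (fun ω h hA hNS hc => ?_) hex
  rcases (ΩG.cost_ext₃_eq_five_iff hr h hNS).1 hc with ⟨hc5, -⟩ | ⟨hc7, hE | hW⟩
  · exact absurd (ΩG.rootRow_of_cost_five hh hr h hA hc5 hcol) (ne_of_gt habove)
  · exact ΩG.phaseIndex_ext₃_of_cost_seven_E_above hh hr h hA hc7 hE hNS habove hcol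
  · exact ΩG.phaseIndex_ext₃_of_cost_seven_W_above hh hr h hA hc7 hW hNS habove hcol

/-- ★★★★★ **THE COLUMN LAW ABOVE THE ROOT ROW**: under the same hypotheses some `θ ∈ (0, π)` has a NON-VANISHING printed vertex functional at `f₀`.
[cite: GlazmanManolescu2019, Lemma 2.1 and eq. (1); Remark 2.2] [cite: Glazman2015WeightedSAW, Lemma 3.1 (proof, pp. 6–7)] -/
theorem vertexFunctional_printed_exists_ne_zero_above {w f₀ : Face} (hh : holeFaceW w ∉ dom Dl)
    (hr : RootedFace (dom Dl) (w.side .W) f₀) (habove : w.2 < f₀.2) (hcol : w.1 ≤ f₀.1)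
    (hex : ∃ (ω : ΩG (dom Dl) (w.side .W) f₀) (h : ω.IsB2a), ω.AJ hr h (toC (midPt (w.side .W))) ≠ 0 ∧
      arcKind (ω.2.sIn ω.2.firstHitG) (ω.2.sOut ω.2.firstHitG) ≠ .straight ∧
        cost (slotOfSide (ω.ext₃ hr).1) (ω.ext₃ hr).2.mids = 5) :
    ∃ θ ∈ Set.Ioo 0 π, vertexFunctional (printedWeights θ) tFiveEighths (ybCoeff θ) Dl (w.side .W) f₀ ≠ 0 := by
  obtain ⟨hfin, -⟩ := vertexFunctional_printed_zero_set_finite_above Dl hh hr habove hcol hex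
  by_contra hno
  push Not at hno
  have hsub : Set.Ioo (0 : ℝ) π ⊆
      {θ ∈ Set.Ioo 0 π | vertexFunctional (printedWeights θ) tFiveEighths (ybCoeff θ) Dl (w.side .W) f₀ = 0} :=
    fun θ hθ => ⟨hθ, hno θ hθ⟩
  exact (Set.Ioo_infinite Real.pi_pos).mono hsub hfin

end Literature.Barriers.CriticalPhenomena.PlaquetteWalk
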